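import Summits.QuantumFields.YangMills.Theorems.UnitScaleTiltProp7GaugeProjectorBlockPackageMember
import HarnessLib

/-!
# Route `UnitScaleTilt`, crux K1 «MinimiserStabilityRegPr» (stmt-QuantumFields-19200), EX row `norm_G`, N6 FILE D — **(W6) THE (c·b) BLOCK PACKAGE AT ONE MEMBER, FAMILIES OF RECORD DISCHARGED:
# ★p1 g27's D3 letters (c1b)(c2b)(c3b) FROM `RegPr` + THE FACE's LIFT ANTECEDENT ALONE (K-free constants of (W5b)) `c₁ = c₀(L³)^{K−n}`** — LOD mass `am`, column slope `μ(am)`, Gram slope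
# `μ′(am) = min (μ∕4) (m_B(am)∕(3Γ(am)))`, RATE `δ₁(am) := μ′(am)∕2`, constants `C₁(am) = C₃(am)`, `C₂(am, ε₀)` CLOSED and MEMBER-FREE (no `K`, `n`, `|T³|`) — the
# member edition of (W4) ✓`Prop7GaugeProjectorBlockPackage.hc1b_of_letters`∕`hc2b_of_letters`∕`hc3b_of_letters` with `hGw` ⟸ (W1) ✓`hGsupW_of_regPr`, `hPw` ⟸ (W4) ✓`hPw_of_spikeKernel` ∘ V5b
# ✓`norm_equiv_sub_projR_single_le_closed`, `hDw` ⟸ (W4) ✓`hDw_of_letters` ∘ (W1) ✓`hpenW_of_regPr`, by px5 g12's ✓`kernelRow349_pin` road (CHAIR WORD №32; width seat `ym3-torus-px5` gen 14).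

Cell `ym3-torus` (HUMAN RULING D-0037; rung R3 = SU(2) YM₃ on T³ — NOT d = 4, NOT infinite volume, NOT a mass gap, NOT Clay).  THEOREMS ONLY (0 `def`, 0 `sorry`);
`--supports stmt-QuantumFields-19200 --as helper`; count-neutral.

THE PIN (★p1 g25∕g26, px5 g12∕g13 precedent ✓`Prop7GaugeProjectorSupPackageMember`).  At `c₁ := c₀(L³)^{K−n}` the raw letters are numbers: `(25∕8)·c₁ℓ⁻³∕c₀ = 25∕8`,
`max 2 (16c₀ℓ³∕(am·c₁)) = max 2 (16∕am)`, `c₀∕c₁ = ((L^d)^{K−n})⁻¹` (print's `η³`), `m_B = 2∕((1 + 25∕8)(600(27∕4)⁶ + am))`; the column window holds with EQUALITY at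
`μ(am) = 1∕(10√(max 2 (16∕am))·√(27 + 2025am∕8))` (✓`window_delta`, ✓`window_win`), the Gram window∕gap at `μ′(am) ≤ μ∕4 < (min μ ¼)∕2` (✓`gap_nonneg`, ✓`gap_le`, ✓`window_gap`:
`3ε(μ′)² < m_B²∕2`, `(m_B²∕2 − 3ε(μ′)²)⁻¹ ≤ 6∕m_B²`, `e^{9μ′} ≤ 3`), the operator rows ✓`norm_lift_topMean_le` ∕ ✓`norm_massive_inverse_le` ∕ ✓`coarseGram_coercive`, and the unit leaves
✓`unitA_pin`∕✓`unitU1_pin`∕✓`unitU3_pin` (V5b's bracket) ∕ ✓`unitP1_pin`∕✓`unitP2_pin`∕✓`unitP3_pin` (V4g's brackets, `mul_one`-read) close every constant; `η³·(L^d)^{K−n} = 1` removes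
the block volume of the P-letter.  The rate `δ₁ = μ′∕2` sits below all three engine rates (`(min μ ¼)∕2`, `μ`, `μ′`), so the convolution volumes are the closed
`(2(1+1∕((min μ ¼)∕2 − δ₁)))³`, `(2(1+1∕(μ − δ₁)))³`, `(2(1+1∕(μ′ − δ₁)))³`.

WHAT IS PROVED (ns `Summit.QuantumFields.YangMills.Theorems.Prop7GaugeProjectorBlockPackageMemberOfLift`; member `F`, `n < K`; LOD letters `Q″ hseq` and the Lift letters `hRS hker`
displayed VERBATIM as in ✓p769532 §1; the LOD data `ι hι T hT G hAG hGA` at the pin with mass `0 < am`).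
* ★★★ **`hc1b_of_lift`**, ★★★ **`hc3b_of_lift`**, ★★★ **`hc2b_of_lift`** — (W5b) ✓`hc1b_pin`∕✓`hc3b_pin`∕✓`hc2b_pin` with the LOD∕Lift letters DISCHARGED exactly as
  ✓`Prop7GaugeProjectorSupPackageMember` §2: `Q″ hseq hker ← exists_intertwiner_of_regPr`, `hRS ← RS_eq_projR_of_lift (hLift)`, `ι` by `rfl`, `T := (ι∘Q″)†` (`LinearMap.adjoint`),
  `G hAG hGA ← exists_massive_inverse` (mass `am`); displayed: `RegPr F n K ε₀ U₀` with `10¹²L³ε₀ ≤ 1`, `n < K`, the face's Lift antecedent `hLift`, `0 < am`, `0 ≤ a′` (+ `hroom`, `hsmall` for (c2b)).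
HYP-SAT (★★OWNER RULING №42).  As ✓p769532: `RegPr` is the face's class; `hseq` ⟸ ✓`exists_intertwiner_of_regPr` (iv); `hRS hker` ⟸ ✓`RS_eq_projR_of_lift` under the Lift antecedent;
`ι` by `rfl`, `T := (ιQ″)†`, `G hAG hGA` ⟸ ✓`exists_massive_inverse` — the `_of_lift` editions (next file) discharge them; `hroom`∕`hsmall` are print's room∕smallness of `ε₀`.
Conclusions are explicit decayed rows with member-free constants; no `Prop` placeholder.
HONEST SCOPE.  Bookkeeping over landed rows; nothing of D1–D3, `norm_G`, the ten EX rows, EX `stub_existenceMinimalOrbit` or the crux is proved here; the Yang–Mills mass gap is NOT proved.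

References: T. Bałaban, CMP **99** (1985) 389–434 [Balaban1985BackgroundPropagators] ((3.20)–(3.25) p.394, Thm 3.1 (3.42)∕(3.46) pp.397–398, (3.49) p.399, (3.118)–(3.122) pp.419–420);
CMP **102** (1985) 277–309 [Balaban1985Variational] ((138)–(139) p.299); CMP **116** (1988) 1–22 [Balaban1988RG2Cluster] ((2.7) p.13).
-/

set_option autoImplicit false

noncomputable section

open scoped BigOperators Matrix.Norms.L2Operator InnerProductSpace ComplexConjugate Matrix

namespace Summit.QuantumFields.YangMills.Theorems.Prop7GaugeProjectorBlockPackageMemberOfLift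

open Literature.MathematicalPhysics.QuantumFieldTheory.Balaban1983to89
open Literature.MathematicalPhysics.QuantumFieldTheory.Balaban1983to89.T3ContinuumYM3Torus
open T4Continuum BlockAveraging
open BlockAveraging (Idx)
open B7Prop1Explicit (disp)
open B5Eq118OneStroke (iterBlockOf)
open B15DeterminingSets (embIter)
open B10Eq27TorusAxialLog (holT transl)
open B7TransferAnalyticMean (meanCLM)
open B4Sect5Torus (TSite)
open B9SectCLatticeCarrier (Bond)
open B9Eq311L2Pairing (WL2)
open B11Eq103H1Complex (SiteL2K BondL2K projR)
open Summit.QuantumFields.YangMills.Theorems.Prop8Chart (emlIterU)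
open T3SectALandauChart (eta eta_pos bgUnits)
open T3PrintedRegularMinimiser (RegPr)
open T3PrintedRegularOrbits (sites_eq)
open T3LevelShift (siteShift)
open Summit.QuantumFields.YangMills.Theorems.Prop7SectET3Transport (periodsT3 siteEquiv bondEquiv)
open Summit.QuantumFields.YangMills.Theorems.Prop7SectET3HilbertLetters (W₂ frobEquiv toL2 toL2S DL2 DstarL2 covLapSite)
open Summit.QuantumFields.YangMills.Theorems.Prop7SectET3GaugeProjector (NS RS)
open Summit.QuantumFields.YangMills.Theorems.Prop7SectET3DeltaPiPInv (GprimeP)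
open Summit.QuantumFields.YangMills.Theorems.Prop7LODSlotK2WindowLetters (window_delta window_win gap_nonneg gap_le window_gap)
open Summit.QuantumFields.YangMills.Theorems.Prop7ComplementaryProjectorBlockDecay (norm_lift_topMean_le norm_massive_inverse_le coarseCoercivity_pos)
open Summit.QuantumFields.YangMills.Theorems.Prop7CoarseGramCoercivity (coarseGram_coercive)
open Summit.QuantumFields.YangMills.Theorems.Prop7KernelRow349Pin (exp_nine_mul_le_three)
open Summit.QuantumFields.YangMills.Theorems.Prop7CurvedMemberGradientRowPin (unitA_pin unitU1_pin unitU3_pin)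
open Summit.QuantumFields.YangMills.Theorems.Prop7PcolMember (unitP1_pin unitP2_pin unitP3_pin)
open Summit.QuantumFields.YangMills.Theorems.Prop7ComplementaryProjectorPointwiseDecayClosed (norm_equiv_sub_projR_single_le_closed)
open Summit.QuantumFields.YangMills.Theorems.Prop7BlockConvolutionWeightedSup (hGsupW_of_regPr hpenW_of_regPr)
open Summit.QuantumFields.YangMills.Theorems.Prop7GaugeProjectorBlockPackage (hc1b_of_letters hc2b_of_letters hc3b_of_letters hPw_of_spikeKernel hDw_of_letters)
open Summit.QuantumFields.YangMills.Theorems.Prop7CurvedMemberLocalGradient (exists_curved_localGradient)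
open Summit.QuantumFields.YangMills.Theorems.AxialGaugeChartGlue (norm_bgOfCfg_axialT_sub_le)
open Summit.QuantumFields.YangMills.Theorems.Prop7GaugeProjectorBlockPackageMember (hc1b_pin hc2b_pin hc3b_pin)
open Summit.QuantumFields.YangMills.Theorems.Prop7NSIntertwinerOfRecord (exists_intertwiner_of_regPr)
open Summit.QuantumFields.YangMills.Theorems.Prop7RSEqPrintProjectorOfLift (RS_eq_projR_of_lift)
open Summit.QuantumFields.YangMills.Theorems.Prop7MassivePropagatorCoercive (exists_massive_inverse)

variable (F : T3Family) {n K : ℕ} (h : n ≤ K) {c₀ cB : ℝ} [Fact (0 < c₀)] [Fact (0 < cB)]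
  {ε₀ : ℝ} (hε₀ : 0 < ε₀)
  (U₀ : GaugeField (F.P K) 0 (Matrix.specialUnitaryGroup (Fin 2) ℂ)) (hreg : RegPr F n K ε₀ U₀)


/-! ## §1 ★★★ D3's (c·b) letters at one member, families of record discharged -/

include hε₀ hreg in
/-- ★★★ **D3's (c1b) AT ONE MEMBER, FAMILIES OF RECORD DISCHARGED** — `Q″ hseq hker ← exists_intertwiner_of_regPr`, `hRS ← RS_eq_projR_of_lift (hLift)`, `ι` by `rfl`, `T := (ι∘Q″)†`, `G ← exists_massive_inverse` (mass `am`); displayed: `RegPr F n K ε₀ U₀` with `10¹²L³ε₀ ≤ 1`, `n < K`, the face's Lift antecedent, `0 ≤ a′`; constant and rate = the member's `C₁(am)`, `δ₁(am)`. [cite: Balaban1985BackgroundPropagators, (3.20)–(3.25) p.394, Thm 3.1 (3.42)∕(3.46) pp.397–398, (3.49) p.399, (3.118)–(3.122) pp.419–420] -/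
theorem hc1b_of_lift (hnK : n < K) (hε12 : 10 ^ 12 * (F.L : ℝ) ^ 3 * ε₀ ≤ 1) {am : ℝ} (ham : 0 < am)
    (hLift : ∀ cf : Site (F.P K) (K - n) → Matrix (Fin 2) (Fin 2) ℂ,
      (∀ e : PBond (F.P K) (K - n), cf e.src = ((emlIterU (K - n) (bgUnits F K U₀) e : (Matrix (Fin 2) (Fin 2) ℂ)ˣ) : Matrix (Fin 2) (Fin 2) ℂ) * cf e.tgt *
        (((emlIterU (K - n) (bgUnits F K U₀) e)⁻¹ : (Matrix (Fin 2) (Fin 2) ℂ)ˣ) : Matrix (Fin 2) (Fin 2) ℂ)) →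
      ∃ l₀ : Site (F.P K) 0 → Matrix (Fin 2) (Fin 2) ℂ,
        (∀ b : PBond (F.P K) 0, l₀ b.src = ((bgUnits F K U₀ b : (Matrix (Fin 2) (Fin 2) ℂ)ˣ) : Matrix (Fin 2) (Fin 2) ℂ) * l₀ b.tgt * (((bgUnits F K U₀ b)⁻¹ : (Matrix (Fin 2) (Fin 2) ℂ)ˣ) : Matrix (Fin 2) (Fin 2) ℂ)) ∧
        ∀ y : Site (F.P K) (K - n), l₀ (embIter (K - n) y) = cf y)
    {a' : ℝ} (ha' : 0 ≤ a') :
    ∀ (v : Site (F.P K) 0 → Matrix (Fin 2) (Fin 2) ℂ) (z : Site (F.P K) (K - n)), (∀ y, v y ≠ 0 → iterBlockOf (K - n) y = z) →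
      ∀ m : ℝ, 0 ≤ m → (∀ y, ‖v y‖ ≤ m) →
        ∀ y : Site (F.P K) 0, ‖(toL2S F K c₀).symm (GprimeP F n K h c₀ cB a' U₀ (RS F n K h c₀ cB U₀ (toL2S F K c₀ v))) y‖
          ≤ m * (Real.sqrt 2 * ((((14 * (8 * Real.exp (3 * min (1 / (10 * Real.sqrt (max 2 (16 / am)) * Real.sqrt (27 + 2025 / 8 * am))) (1 / 4)) * (1 + Real.exp (3 * (1 / (10 * Real.sqrt (max 2 (16 / am)) * Real.sqrt (27 + 2025 / 8 * am)))) * (am * ((5 / 4) * Real.sqrt 2) * Real.sqrt (25 / 8) * (8 * Real.sqrt (max 2 (16 / am)) ^ 2))))) + (Real.sqrt 216 * (Real.sqrt (8 * Real.exp (3 * min (1 / (10 * Real.sqrt (max 2 (16 / am)) * Real.sqrt (27 + 2025 / 8 * am))) (1 / 4)) * Real.exp (6 * (1 / (10 * Real.sqrt (max 2 (16 / am)) * Real.sqrt (27 + 2025 / 8 * am)))) * (2 * (1 + 1 / (1 / (10 * Real.sqrt (max 2 (16 / am)) * Real.sqrt (27 + 2025 / 8 * am))))) ^ 3) * (8 *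 Real.sqrt (max 2 (16 / am)) ^ 2)))) * (2 * (1 + 1 / (min (1 / (10 * Real.sqrt (max 2 (16 / am)) * Real.sqrt (27 + 2025 / 8 * am))) (1 / 4) / 2 - (min ((1 / (10 * Real.sqrt (max 2 (16 / am)) * Real.sqrt (27 + 2025 / 8 * am))) / 4) ((2 / ((1 + 25 / 8) * (600 * (27 / 4 : ℝ) ^ 6 + am))) / (3 * (Real.sqrt (max 2 (16 / am)) * (2 + Real.sqrt (max 2 (16 / am))) * (3 * Real.sqrt 3 + 27 + 9 * Real.sqrt am * Real.sqrt (25 / 8) + 81 * am * (25 / 8)) * (8 * Real.sqrt (max 2 (16 / am)) + 8 * Real.sqrt (max 2 (16 / am)) ^ 2) * (10 * Real.sqrt (25 / 8)) + 9 * (max 2 (16 / am)) * Real.sqrt (25 / 8))))) / 2))) ^ 3) * (1 + ((((14 * (8 * Real.exp (3 * min (1 / (10 * Real.sqrt (max 2 (16 / am)) * Real.sqrt (27 + 2025 / 8 * am))) (1 / 4)) * ((5 / 2 : ℝ) + Real.exp (3 * (1 / (10 * Real.sqrt (max 2 (16 / am)) * Real.sqrt (27 + 2025 / 8 * am)))) *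 ((am * (5 / 2) * (25 / 8) * (8 * max 2 (16 / am))))))) + (Real.sqrt 432 * (Real.sqrt (8 * Real.exp (3 * min (1 / (10 * Real.sqrt (max 2 (16 / am)) * Real.sqrt (27 + 2025 / 8 * am))) (1 / 4)) * Real.exp (6 * (1 / (10 * Real.sqrt (max 2 (16 / am)) * Real.sqrt (27 + 2025 / 8 * am)))) * (2 * (1 + 1 / (1 / (10 * Real.sqrt (max 2 (16 / am)) * Real.sqrt (27 + 2025 / 8 * am))))) ^ 3) * ((8 * max 2 (16 / am)) * Real.sqrt (25 / 8))))) ^ 2 * (6 / (2 / ((1 + 25 / 8) * (600 * (27 / 4 : ℝ) ^ 6 + am))) ^ 2 * 3) * (4 * (2 * (1 + 1 / ((min (1 / (10 * Real.sqrt (max 2 (16 / am)) * Real.sqrt (27 + 2025 / 8 * am))) (1 / 4) / 2) - min ((1 / (10 * Real.sqrt (max 2 (16 / am)) * Real.sqrt (27 + 2025 / 8 * am))) / 4) ((2 / ((1 + 25 / 8) * (600 * (27 / 4 : ℝ) ^ 6 + am))) / (3 * (Real.sqrt (max 2 (16 / am)) * (2 + Real.sqrt (max 2 (16 / am))) * (3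 * Real.sqrt 3 + 27 + 9 * Real.sqrt am * Real.sqrt (25 / 8) + 81 * am * (25 / 8)) * (8 * Real.sqrt (max 2 (16 / am)) + 8 * Real.sqrt (max 2 (16 / am)) ^ 2) * (10 * Real.sqrt (25 / 8)) + 9 * (max 2 (16 / am)) * Real.sqrt (25 / 8))))))) ^ 3) ^ 2) * (2 * (1 + 1 / (min ((1 / (10 * Real.sqrt (max 2 (16 / am)) * Real.sqrt (27 + 2025 / 8 * am))) / 4) ((2 / ((1 + 25 / 8) * (600 * (27 / 4 : ℝ) ^ 6 + am))) / (3 * (Real.sqrt (max 2 (16 / am)) * (2 + Real.sqrt (max 2 (16 / am))) * (3 * Real.sqrt 3 + 27 + 9 * Real.sqrt am * Real.sqrt (25 / 8) + 81 * am * (25 / 8)) * (8 * Real.sqrt (max 2 (16 / am)) + 8 * Real.sqrt (max 2 (16 / am)) ^ 2) * (10 * Real.sqrt (25 / 8)) + 9 * (max 2 (16 / am)) * Real.sqrt (25 / 8)))) - (min ((1 / (10 * Real.sqrt (max 2 (16 / am)) * Real.sqrt (27 + 2025 / 8 * am))) / 4) ((2 / ((1 + 25 / 8) * (600 * (27 /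 4 : ℝ) ^ 6 + am))) / (3 * (Real.sqrt (max 2 (16 / am)) * (2 + Real.sqrt (max 2 (16 / am))) * (3 * Real.sqrt 3 + 27 + 9 * Real.sqrt am * Real.sqrt (25 / 8) + 81 * am * (25 / 8)) * (8 * Real.sqrt (max 2 (16 / am)) + 8 * Real.sqrt (max 2 (16 / am)) ^ 2) * (10 * Real.sqrt (25 / 8)) + 9 * (max 2 (16 / am)) * Real.sqrt (25 / 8))))) / 2))) ^ 3)))) * Real.exp (-((min ((1 / (10 * Real.sqrt (max 2 (16 / am)) * Real.sqrt (27 + 2025 / 8 * am))) / 4) ((2 / ((1 + 25 / 8) * (600 * (27 / 4 : ℝ) ^ 6 + am))) / (3 * (Real.sqrt (max 2 (16 / am)) * (2 + Real.sqrt (max 2 (16 / am))) * (3 * Real.sqrt 3 + 27 + 9 * Real.sqrt am * Real.sqrt (25 / 8) + 81 * am * (25 / 8)) * (8 * Real.sqrt (max 2 (16 / am)) + 8 * Real.sqrt (max 2 (16 / am)) ^ 2) * (10 * Real.sqrt (25 / 8)) + 9 * (max 2 (16 / am)) * Real.sqrt (25 / 8))))) / 2 * (Site.tdist (P := F.P K)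 (iterBlockOf (K - n) y) z : ℝ))) := by
  have hc₀ : 0 < c₀ := Fact.out
  have hL : (0 : ℝ) < F.L := by have := F.hL.2; exact_mod_cast (by omega : 0 < F.L)
  have hε7 : 10 ^ 7 * (F.L : ℝ) ^ 3 * ε₀ ≤ 1 := by
    have h1 : (10 : ℝ) ^ 7 * (F.L : ℝ) ^ 3 * ε₀ ≤ 10 ^ 12 * (F.L : ℝ) ^ 3 * ε₀ := by
      have : 0 ≤ (F.L : ℝ) ^ 3 * ε₀ := by positivity
      nlinarith only [this]
    exact h1.trans hε12
  -- the `Q″` of record, its ∃-form top-mean clause and `ker Q″ ≤ N_S`; the Lift identity `R_S = projR Δ Q″`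
  obtain ⟨Q'', D', -, -, htop, hseq, hker⟩ := exists_intertwiner_of_regPr F h (c₀ := c₀) cB hε₀ hε12 U₀ hreg
  have hRS := RS_eq_projR_of_lift F h cB hε₀ hε12 U₀ hreg hLift Q'' htop hker
  -- the LOD data at the pinned weight: `ι` by `rfl`, `T := (ι∘Q″)†`, `G ← exists_massive_inverse`
  haveI : Fact (0 < (c₀ * ((F.L : ℝ) ^ 3) ^ (K - n))) := ⟨by positivity⟩
  obtain ⟨ι', hι'⟩ : ∃ ι' : (Site (F.P K) (K - n) → Matrix (Fin 2) (Fin 2) ℂ) →ₗ[ℂ] SiteL2K ℂ 3 (periodsT3 F n) (c₀ * ((F.L : ℝ) ^ 3) ^ (K - n)) W₂,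
      ∀ c, ι' c = toL2S F n (c₀ * ((F.L : ℝ) ^ 3) ^ (K - n)) (fun z => c (siteShift (sites_eq F n K h) z)) :=
    ⟨(toL2S F n (c₀ * ((F.L : ℝ) ^ 3) ^ (K - n))).toLinearMap ∘ₗ LinearMap.funLeft ℂ (Matrix (Fin 2) (Fin 2) ℂ) (siteShift (sites_eq F n K h)), fun c => rfl⟩
  obtain ⟨T', hT'⟩ : ∃ T' : SiteL2K ℂ 3 (periodsT3 F n) (c₀ * ((F.L : ℝ) ^ 3) ^ (K - n)) W₂ →ₗ[ℂ] SiteL2K ℂ 3 (periodsT3 F K) c₀ W₂,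
      ∀ (l : SiteL2K ℂ 3 (periodsT3 F K) c₀ W₂) (f : SiteL2K ℂ 3 (periodsT3 F n) (c₀ * ((F.L : ℝ) ^ 3) ^ (K - n)) W₂), ⟪ι' (Q'' l), f⟫_ℂ = ⟪l, T' f⟫_ℂ :=
    ⟨LinearMap.adjoint (ι' ∘ₗ Q''), fun l f => by rw [LinearMap.adjoint_inner_right, LinearMap.comp_apply]⟩
  obtain ⟨G', hAG', hGA', -⟩ := exists_massive_inverse F h hε₀ hε7 U₀ hreg Q'' hseq ι' hι' T' hT' ham
  exact hc1b_pin F h hε₀ hε7 U₀ hreg Q'' hseq hRS hker hnK ham ι' hι' T' hT' G' hAG' hGA' ha'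

include hε₀ hreg in
/-- ★★★ **D3's (c3b) AT ONE MEMBER, FAMILIES OF RECORD DISCHARGED** (same discharge; constant `C₃ = C₁`). [cite: Balaban1985BackgroundPropagators, (3.21)–(3.25) p.394, Thm 3.1 (3.42)∕(3.46) pp.397–398, (3.49) p.399] -/
theorem hc3b_of_lift (hnK : n < K) (hε12 : 10 ^ 12 * (F.L : ℝ) ^ 3 * ε₀ ≤ 1) {am : ℝ} (ham : 0 < am)
    (hLift : ∀ cf : Site (F.P K) (K - n) → Matrix (Fin 2) (Fin 2) ℂ,
      (∀ e : PBond (F.P K) (K - n), cf e.src = ((emlIterU (K - n) (bgUnits F K U₀) e : (Matrix (Fin 2) (Fin 2) ℂ)ˣ) : Matrix (Fin 2) (Fin 2) ℂ) * cf e.tgt *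
        (((emlIterU (K - n) (bgUnits F K U₀) e)⁻¹ : (Matrix (Fin 2) (Fin 2) ℂ)ˣ) : Matrix (Fin 2) (Fin 2) ℂ)) →
      ∃ l₀ : Site (F.P K) 0 → Matrix (Fin 2) (Fin 2) ℂ,
        (∀ b : PBond (F.P K) 0, l₀ b.src = ((bgUnits F K U₀ b : (Matrix (Fin 2) (Fin 2) ℂ)ˣ) : Matrix (Fin 2) (Fin 2) ℂ) * l₀ b.tgt * (((bgUnits F K U₀ b)⁻¹ : (Matrix (Fin 2) (Fin 2) ℂ)ˣ) : Matrix (Fin 2) (Fin 2) ℂ)) ∧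
        ∀ y : Site (F.P K) (K - n), l₀ (embIter (K - n) y) = cf y)
    {a' : ℝ} (ha' : 0 ≤ a') :
    ∀ (v : Site (F.P K) 0 → Matrix (Fin 2) (Fin 2) ℂ) (z : Site (F.P K) (K - n)), (∀ y, v y ≠ 0 → iterBlockOf (K - n) y = z) →
      ∀ m : ℝ, 0 ≤ m → (∀ y, ‖v y‖ ≤ m) →
        ∀ y : Site (F.P K) 0, ‖(toL2S F K c₀).symm (RS F n K h c₀ cB U₀ (GprimeP F n K h c₀ cB a' U₀ (toL2S F K c₀ v))) y‖
          ≤ m * (Real.sqrt 2 * ((((14 * (8 * Real.exp (3 * min (1 / (10 * Real.sqrt (max 2 (16 / am)) * Real.sqrt (27 + 2025 / 8 * am))) (1 / 4)) * (1 + Real.exp (3 * (1 / (10 * Real.sqrt (max 2 (16 / am)) * Real.sqrt (27 + 2025 / 8 * am)))) * (am * ((5 / 4) * Real.sqrt 2) * Real.sqrt (25 / 8) * (8 * Real.sqrt (max 2 (16 / am)) ^ 2))))) + (Real.sqrt 216 * (Real.sqrt (8 * Real.exp (3 * min (1 / (10 * Real.sqrt (max 2 (16 / am)) * Real.sqrt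 (27 + 2025 / 8 * am))) (1 / 4)) * Real.exp (6 * (1 / (10 * Real.sqrt (max 2 (16 / am)) * Real.sqrt (27 + 2025 / 8 * am)))) * (2 * (1 + 1 / (1 / (10 * Real.sqrt (max 2 (16 / am)) * Real.sqrt (27 + 2025 / 8 * am))))) ^ 3) * (8 * Real.sqrt (max 2 (16 / am)) ^ 2)))) * (2 * (1 + 1 / (min (1 / (10 * Real.sqrt (max 2 (16 / am)) * Real.sqrt (27 + 2025 / 8 * am))) (1 / 4) / 2 - (min ((1 / (10 * Real.sqrt (max 2 (16 / am)) * Real.sqrt (27 + 2025 / 8 * am))) / 4) ((2 / ((1 + 25 / 8) * (600 * (27 / 4 : ℝ) ^ 6 + am))) / (3 * (Real.sqrt (max 2 (16 / am)) * (2 + Real.sqrt (max 2 (16 / am))) * (3 * Real.sqrt 3 + 27 + 9 * Real.sqrt am * Real.sqrt (25 / 8) + 81 * am * (25 / 8)) * (8 * Real.sqrt (max 2 (16 / am)) + 8 * Real.sqrt (max 2 (16 / am)) ^ 2) * (10 * Real.sqrt (25 / 8)) + 9 * (max 2 (16 / am)) * Real.sqrt (25 / 8))))) / 2))) ^ 3)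 * (1 + ((((14 * (8 * Real.exp (3 * min (1 / (10 * Real.sqrt (max 2 (16 / am)) * Real.sqrt (27 + 2025 / 8 * am))) (1 / 4)) * ((5 / 2 : ℝ) + Real.exp (3 * (1 / (10 * Real.sqrt (max 2 (16 / am)) * Real.sqrt (27 + 2025 / 8 * am)))) * ((am * (5 / 2) * (25 / 8) * (8 * max 2 (16 / am))))))) + (Real.sqrt 432 * (Real.sqrt (8 * Real.exp (3 * min (1 / (10 * Real.sqrt (max 2 (16 / am)) * Real.sqrt (27 + 2025 / 8 * am))) (1 / 4)) * Real.exp (6 * (1 / (10 * Real.sqrt (max 2 (16 / am)) * Real.sqrt (27 + 2025 / 8 * am)))) * (2 * (1 + 1 / (1 / (10 * Real.sqrt (max 2 (16 / am)) * Real.sqrt (27 + 2025 / 8 * am))))) ^ 3) * ((8 * max 2 (16 / am)) * Real.sqrt (25 / 8))))) ^ 2 * (6 / (2 / ((1 + 25 / 8) * (600 * (27 / 4 : ℝ) ^ 6 + am))) ^ 2 * 3) * (4 * (2 * (1 + 1 / ((min (1 / (10 * Real.sqrt (max 2 (16 / am)) * Real.sqrt (27 + 2025 / 8 * am))) (1 /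 4) / 2) - min ((1 / (10 * Real.sqrt (max 2 (16 / am)) * Real.sqrt (27 + 2025 / 8 * am))) / 4) ((2 / ((1 + 25 / 8) * (600 * (27 / 4 : ℝ) ^ 6 + am))) / (3 * (Real.sqrt (max 2 (16 / am)) * (2 + Real.sqrt (max 2 (16 / am))) * (3 * Real.sqrt 3 + 27 + 9 * Real.sqrt am * Real.sqrt (25 / 8) + 81 * am * (25 / 8)) * (8 * Real.sqrt (max 2 (16 / am)) + 8 * Real.sqrt (max 2 (16 / am)) ^ 2) * (10 * Real.sqrt (25 / 8)) + 9 * (max 2 (16 / am)) * Real.sqrt (25 / 8))))))) ^ 3) ^ 2) * (2 * (1 + 1 / (min ((1 / (10 * Real.sqrt (max 2 (16 / am)) * Real.sqrt (27 + 2025 / 8 * am))) / 4) ((2 / ((1 + 25 / 8) * (600 * (27 / 4 : ℝ) ^ 6 + am))) / (3 * (Real.sqrt (max 2 (16 / am)) * (2 + Real.sqrt (max 2 (16 / am))) * (3 * Real.sqrt 3 + 27 + 9 * Real.sqrt am * Real.sqrt (25 / 8) + 81 * am * (25 / 8)) * (8 * Real.sqrt (max 2 (16 / am)) + 8 * Real.sqrt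 (max 2 (16 / am)) ^ 2) * (10 * Real.sqrt (25 / 8)) + 9 * (max 2 (16 / am)) * Real.sqrt (25 / 8)))) - (min ((1 / (10 * Real.sqrt (max 2 (16 / am)) * Real.sqrt (27 + 2025 / 8 * am))) / 4) ((2 / ((1 + 25 / 8) * (600 * (27 / 4 : ℝ) ^ 6 + am))) / (3 * (Real.sqrt (max 2 (16 / am)) * (2 + Real.sqrt (max 2 (16 / am))) * (3 * Real.sqrt 3 + 27 + 9 * Real.sqrt am * Real.sqrt (25 / 8) + 81 * am * (25 / 8)) * (8 * Real.sqrt (max 2 (16 / am)) + 8 * Real.sqrt (max 2 (16 / am)) ^ 2) * (10 * Real.sqrt (25 / 8)) + 9 * (max 2 (16 / am)) * Real.sqrt (25 / 8))))) / 2))) ^ 3)))) * Real.exp (-((min ((1 / (10 * Real.sqrt (max 2 (16 / am)) * Real.sqrt (27 + 2025 / 8 * am))) / 4) ((2 / ((1 + 25 / 8) * (600 * (27 / 4 : ℝ) ^ 6 + am))) / (3 * (Real.sqrt (max 2 (16 / am)) * (2 + Real.sqrt (max 2 (16 / am))) * (3 * Real.sqrt 3 + 27 + 9 * Real.sqrt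 am * Real.sqrt (25 / 8) + 81 * am * (25 / 8)) * (8 * Real.sqrt (max 2 (16 / am)) + 8 * Real.sqrt (max 2 (16 / am)) ^ 2) * (10 * Real.sqrt (25 / 8)) + 9 * (max 2 (16 / am)) * Real.sqrt (25 / 8))))) / 2 * (Site.tdist (P := F.P K) (iterBlockOf (K - n) y) z : ℝ))) := by
  have hc₀ : 0 < c₀ := Fact.out
  have hL : (0 : ℝ) < F.L := by have := F.hL.2; exact_mod_cast (by omega : 0 < F.L)
  have hε7 : 10 ^ 7 * (F.L : ℝ) ^ 3 * ε₀ ≤ 1 := by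
    have h1 : (10 : ℝ) ^ 7 * (F.L : ℝ) ^ 3 * ε₀ ≤ 10 ^ 12 * (F.L : ℝ) ^ 3 * ε₀ := by
      have : 0 ≤ (F.L : ℝ) ^ 3 * ε₀ := by positivity
      nlinarith only [this]
    exact h1.trans hε12
  -- the `Q″` of record, its ∃-form top-mean clause and `ker Q″ ≤ N_S`; the Lift identity `R_S = projR Δ Q″`
  obtain ⟨Q'', D', -, -, htop, hseq, hker⟩ := exists_intertwiner_of_regPr F h (c₀ := c₀) cB hε₀ hε12 U₀ hreg
  have hRS := RS_eq_projR_of_lift F h cB hε₀ hε12 U₀ hreg hLift Q'' htop hker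
  -- the LOD data at the pinned weight: `ι` by `rfl`, `T := (ι∘Q″)†`, `G ← exists_massive_inverse`
  haveI : Fact (0 < (c₀ * ((F.L : ℝ) ^ 3) ^ (K - n))) := ⟨by positivity⟩
  obtain ⟨ι', hι'⟩ : ∃ ι' : (Site (F.P K) (K - n) → Matrix (Fin 2) (Fin 2) ℂ) →ₗ[ℂ] SiteL2K ℂ 3 (periodsT3 F n) (c₀ * ((F.L : ℝ) ^ 3) ^ (K - n)) W₂,
      ∀ c, ι' c = toL2S F n (c₀ * ((F.L : ℝ) ^ 3) ^ (K - n)) (fun z => c (siteShift (sites_eq F n K h) z)) :=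
    ⟨(toL2S F n (c₀ * ((F.L : ℝ) ^ 3) ^ (K - n))).toLinearMap ∘ₗ LinearMap.funLeft ℂ (Matrix (Fin 2) (Fin 2) ℂ) (siteShift (sites_eq F n K h)), fun c => rfl⟩
  obtain ⟨T', hT'⟩ : ∃ T' : SiteL2K ℂ 3 (periodsT3 F n) (c₀ * ((F.L : ℝ) ^ 3) ^ (K - n)) W₂ →ₗ[ℂ] SiteL2K ℂ 3 (periodsT3 F K) c₀ W₂,
      ∀ (l : SiteL2K ℂ 3 (periodsT3 F K) c₀ W₂) (f : SiteL2K ℂ 3 (periodsT3 F n) (c₀ * ((F.L : ℝ) ^ 3) ^ (K - n)) W₂), ⟪ι' (Q'' l), f⟫_ℂ = ⟪l, T' f⟫_ℂ :=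
    ⟨LinearMap.adjoint (ι' ∘ₗ Q''), fun l f => by rw [LinearMap.adjoint_inner_right, LinearMap.comp_apply]⟩
  obtain ⟨G', hAG', hGA', -⟩ := exists_massive_inverse F h hε₀ hε7 U₀ hreg Q'' hseq ι' hι' T' hT' ham
  exact hc3b_pin F h hε₀ hε7 U₀ hreg Q'' hseq hRS hker hnK ham ι' hι' T' hT' G' hAG' hGA' ha'

include hε₀ hreg in
-- HEARTBEAT rule (README): the closed constant is re-elaborated at the `exact`; budgeted decl-locally (disclosed), as ✓p769532 §2.
set_option maxHeartbeats 400000 in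
/-- ★★★ **D3's (c2b) AT ONE MEMBER, FAMILIES OF RECORD DISCHARGED** (same discharge; `hroom`∕`hsmall` displayed; constant `C₂(am, ε₀)`). [cite: Balaban1985BackgroundPropagators, (3.25) p.394, Thm 3.1 (3.42)–(3.44) pp.397–398, (3.49) p.399; Balaban1985Variational, (139) p.299] -/
theorem hc2b_of_lift (hnK : n < K) (hε12 : 10 ^ 12 * (F.L : ℝ) ^ 3 * ε₀ ≤ 1) {am : ℝ} (ham : 0 < am)
    (hLift : ∀ cf : Site (F.P K) (K - n) → Matrix (Fin 2) (Fin 2) ℂ,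
      (∀ e : PBond (F.P K) (K - n), cf e.src = ((emlIterU (K - n) (bgUnits F K U₀) e : (Matrix (Fin 2) (Fin 2) ℂ)ˣ) : Matrix (Fin 2) (Fin 2) ℂ) * cf e.tgt *
        (((emlIterU (K - n) (bgUnits F K U₀) e)⁻¹ : (Matrix (Fin 2) (Fin 2) ℂ)ˣ) : Matrix (Fin 2) (Fin 2) ℂ)) →
      ∃ l₀ : Site (F.P K) 0 → Matrix (Fin 2) (Fin 2) ℂ,
        (∀ b : PBond (F.P K) 0, l₀ b.src = ((bgUnits F K U₀ b : (Matrix (Fin 2) (Fin 2) ℂ)ˣ) : Matrix (Fin 2) (Fin 2) ℂ) * l₀ b.tgt * (((bgUnits F K U₀ b)⁻¹ : (Matrix (Fin 2) (Fin 2) ℂ)ˣ) : Matrix (Fin 2) (Fin 2) ℂ)) ∧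
        ∀ y : Site (F.P K) (K - n), l₀ (embIter (K - n) y) = cf y)
    {a' : ℝ} (ha' : 0 ≤ a')
    (hroom : 2 * (12 * F.L ^ (K - n) + 5) ≤ (F.P K).sitesPerDir 0)
    (hsmall : exists_curved_localGradient.choose * ((48 * ε₀) * (6 * Real.sqrt 2 * Real.sqrt 10 + 6 * Real.sqrt 2)) * Real.exp (51 * ((min ((1 / (10 * Real.sqrt (max 2 (16 / am)) * Real.sqrt (27 + 2025 / 8 * am))) / 4) ((2 / ((1 + 25 / 8) * (600 * (27 / 4 : ℝ) ^ 6 + am))) / (3 * (Real.sqrt (max 2 (16 / am)) * (2 + Real.sqrt (max 2 (16 / am))) * (3 * Real.sqrt 3 + 27 + 9 * Real.sqrt am * Real.sqrt (25 / 8) + 81 * am * (25 / 8)) * (8 * Real.sqrt (max 2 (16 / am)) + 8 * Real.sqrt (max 2 (16 / am)) ^ 2) * (10 * Real.sqrt (25 / 8)) + 9 * (max 2 (16 / am)) * Real.sqrt (25 / 8))))) / 2)) ≤ 1 / 2) :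
    ∀ (v : Site (F.P K) 0 → Matrix (Fin 2) (Fin 2) ℂ) (z : Site (F.P K) (K - n)), (∀ y, v y ≠ 0 → iterBlockOf (K - n) y = z) →
      ∀ m : ℝ, 0 ≤ m → (∀ y, ‖v y‖ ≤ m) →
        ∀ b : PBond (F.P K) 0, ‖(toL2 F K c₀).symm (DL2 F n K c₀ U₀ (GprimeP F n K h c₀ cB a' U₀ (RS F n K h c₀ cB U₀ (toL2S F K c₀ v)))) b‖
          ≤ m * (Real.sqrt 2 * (((2 * ((exists_curved_localGradient.choose * (((((14 * (8 * Real.exp (3 * min (1 / (10 * Real.sqrt (max 2 (16 / am)) * Real.sqrt (27 + 2025 / 8 * am))) (1 / 4)) * (1 + Real.exp (3 * (1 / (10 * Real.sqrt (max 2 (16 / am)) * Real.sqrt (27 + 2025 / 8 * am)))) * (am * ((5 / 4) * Real.sqrt 2) * Real.sqrt (25 / 8) * (8 * Real.sqrt (max 2 (16 / am)) ^ 2))))) + (Real.sqrt 216 * (Real.sqrt (8 * Real.exp (3 * min (1 / (10 * Real.sqrt (max 2 (16 / am)) * Real.sqrt (27 + 2025 / 8 * am))) (1 / 4)) * Real.exp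 (6 * (1 / (10 * Real.sqrt (max 2 (16 / am)) * Real.sqrt (27 + 2025 / 8 * am)))) * (2 * (1 + 1 / (1 / (10 * Real.sqrt (max 2 (16 / am)) * Real.sqrt (27 + 2025 / 8 * am))))) ^ 3) * (8 * Real.sqrt (max 2 (16 / am)) ^ 2)))) * (2 * (1 + 1 / (min (1 / (10 * Real.sqrt (max 2 (16 / am)) * Real.sqrt (27 + 2025 / 8 * am))) (1 / 4) / 2 - (min ((1 / (10 * Real.sqrt (max 2 (16 / am)) * Real.sqrt (27 + 2025 / 8 * am))) / 4) ((2 / ((1 + 25 / 8) * (600 * (27 / 4 : ℝ) ^ 6 + am))) / (3 * (Real.sqrt (max 2 (16 / am)) * (2 + Real.sqrt (max 2 (16 / am))) * (3 * Real.sqrt 3 + 27 + 9 * Real.sqrt am * Real.sqrt (25 / 8) + 81 * am * (25 / 8)) * (8 * Real.sqrt (max 2 (16 / am)) + 8 * Real.sqrt (max 2 (16 / am)) ^ 2) * (10 * Real.sqrt (25 / 8)) + 9 * (max 2 (16 / am)) * Real.sqrt (25 / 8))))) / 2))) ^ 3) * Real.exp (51 * ((min ((1 / (10 * Real.sqrt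 (max 2 (16 / am)) * Real.sqrt (27 + 2025 / 8 * am))) / 4) ((2 / ((1 + 25 / 8) * (600 * (27 / 4 : ℝ) ^ 6 + am))) / (3 * (Real.sqrt (max 2 (16 / am)) * (2 + Real.sqrt (max 2 (16 / am))) * (3 * Real.sqrt 3 + 27 + 9 * Real.sqrt am * Real.sqrt (25 / 8) + 81 * am * (25 / 8)) * (8 * Real.sqrt (max 2 (16 / am)) + 8 * Real.sqrt (max 2 (16 / am)) ^ 2) * (10 * Real.sqrt (25 / 8)) + 9 * (max 2 (16 / am)) * Real.sqrt (25 / 8))))) / 2))) * (2 + 2 * Real.sqrt 2 * (4 * ε₀ * (3 + 2457 * norm_bgOfCfg_axialT_sub_le.choose)) + (24 * Real.sqrt 10 + 48) * (48 * ε₀) ^ 2) + (((am * ((5 / 4) * Real.sqrt 2) * Real.sqrt (25 / 8) * (Real.exp (3 * (1 / (10 * Real.sqrt (max 2 (16 / am)) * Real.sqrt (27 + 2025 / 8 * am)))) * (8 * Real.sqrt (max 2 (16 / am)) ^ 2))) * (2 * (1 + 1 / ((1 / (10 * Real.sqrt (max 2 (16 / am)) * Real.sqrt (27 + 2025 / 8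 * am))) - (min ((1 / (10 * Real.sqrt (max 2 (16 / am)) * Real.sqrt (27 + 2025 / 8 * am))) / 4) ((2 / ((1 + 25 / 8) * (600 * (27 / 4 : ℝ) ^ 6 + am))) / (3 * (Real.sqrt (max 2 (16 / am)) * (2 + Real.sqrt (max 2 (16 / am))) * (3 * Real.sqrt 3 + 27 + 9 * Real.sqrt am * Real.sqrt (25 / 8) + 81 * am * (25 / 8)) * (8 * Real.sqrt (max 2 (16 / am)) + 8 * Real.sqrt (max 2 (16 / am)) ^ 2) * (10 * Real.sqrt (25 / 8)) + 9 * (max 2 (16 / am)) * Real.sqrt (25 / 8))))) / 2))) ^ 3) + 1) * Real.exp (51 * ((min ((1 / (10 * Real.sqrt (max 2 (16 / am)) * Real.sqrt (27 + 2025 / 8 * am))) / 4) ((2 / ((1 + 25 / 8) * (600 * (27 / 4 : ℝ) ^ 6 + am))) / (3 * (Real.sqrt (max 2 (16 / am)) * (2 + Real.sqrt (max 2 (16 / am))) * (3 * Real.sqrt 3 + 27 + 9 * Real.sqrt am * Real.sqrt (25 / 8) + 81 * am * (25 / 8)) * (8 * Real.sqrt (max 2 (16 / am)) + 8 * Real.sqrt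 (max 2 (16 / am)) ^ 2) * (10 * Real.sqrt (25 / 8)) + 9 * (max 2 (16 / am)) * Real.sqrt (25 / 8))))) / 2))) + 2 * Real.sqrt 2 * (48 * ε₀) * ((((14 * (8 * Real.exp (3 * min (1 / (10 * Real.sqrt (max 2 (16 / am)) * Real.sqrt (27 + 2025 / 8 * am))) (1 / 4)) * (1 + Real.exp (3 * (1 / (10 * Real.sqrt (max 2 (16 / am)) * Real.sqrt (27 + 2025 / 8 * am)))) * (am * ((5 / 4) * Real.sqrt 2) * Real.sqrt (25 / 8) * (8 * Real.sqrt (max 2 (16 / am)) ^ 2))))) + (Real.sqrt 216 * (Real.sqrt (8 * Real.exp (3 * min (1 / (10 * Real.sqrt (max 2 (16 / am)) * Real.sqrt (27 + 2025 / 8 * am))) (1 / 4)) * Real.exp (6 * (1 / (10 * Real.sqrt (max 2 (16 / am)) * Real.sqrt (27 + 2025 / 8 * am)))) * (2 * (1 + 1 / (1 / (10 * Real.sqrt (max 2 (16 / am)) * Real.sqrt (27 + 2025 / 8 * am))))) ^ 3) * (8 * Real.sqrt (max 2 (16 / am)) ^ 2)))) * (2 * (1 + 1 / (min (1 / (10 *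 Real.sqrt (max 2 (16 / am)) * Real.sqrt (27 + 2025 / 8 * am))) (1 / 4) / 2 - (min ((1 / (10 * Real.sqrt (max 2 (16 / am)) * Real.sqrt (27 + 2025 / 8 * am))) / 4) ((2 / ((1 + 25 / 8) * (600 * (27 / 4 : ℝ) ^ 6 + am))) / (3 * (Real.sqrt (max 2 (16 / am)) * (2 + Real.sqrt (max 2 (16 / am))) * (3 * Real.sqrt 3 + 27 + 9 * Real.sqrt am * Real.sqrt (25 / 8) + 81 * am * (25 / 8)) * (8 * Real.sqrt (max 2 (16 / am)) + 8 * Real.sqrt (max 2 (16 / am)) ^ 2) * (10 * Real.sqrt (25 / 8)) + 9 * (max 2 (16 / am)) * Real.sqrt (25 / 8))))) / 2))) ^ 3) * Real.exp (51 * ((min ((1 / (10 * Real.sqrt (max 2 (16 / am)) * Real.sqrt (27 + 2025 / 8 * am))) / 4) ((2 / ((1 + 25 / 8) * (600 * (27 / 4 : ℝ) ^ 6 + am))) / (3 * (Real.sqrt (max 2 (16 / am)) * (2 + Real.sqrt (max 2 (16 / am))) * (3 * Real.sqrt 3 + 27 + 9 * Real.sqrt am * Real.sqrt (25 / 8) +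 81 * am * (25 / 8)) * (8 * Real.sqrt (max 2 (16 / am)) + 8 * Real.sqrt (max 2 (16 / am)) ^ 2) * (10 * Real.sqrt (25 / 8)) + 9 * (max 2 (16 / am)) * Real.sqrt (25 / 8))))) / 2))))))) * (1 + ((((14 * (8 * Real.exp (3 * min (1 / (10 * Real.sqrt (max 2 (16 / am)) * Real.sqrt (27 + 2025 / 8 * am))) (1 / 4)) * ((5 / 2 : ℝ) + Real.exp (3 * (1 / (10 * Real.sqrt (max 2 (16 / am)) * Real.sqrt (27 + 2025 / 8 * am)))) * ((am * (5 / 2) * (25 / 8) * (8 * max 2 (16 / am))))))) + (Real.sqrt 432 * (Real.sqrt (8 * Real.exp (3 * min (1 / (10 * Real.sqrt (max 2 (16 / am)) * Real.sqrt (27 + 2025 / 8 * am))) (1 / 4)) * Real.exp (6 * (1 / (10 * Real.sqrt (max 2 (16 / am)) * Real.sqrt (27 + 2025 / 8 * am)))) * (2 * (1 + 1 / (1 / (10 * Real.sqrt (max 2 (16 / am)) * Real.sqrt (27 + 2025 / 8 * am))))) ^ 3) * ((8 * max 2 (16 / am)) * Real.sqrt (25 / 8))))) ^ 2 * (6 /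 (2 / ((1 + 25 / 8) * (600 * (27 / 4 : ℝ) ^ 6 + am))) ^ 2 * 3) * (4 * (2 * (1 + 1 / ((min (1 / (10 * Real.sqrt (max 2 (16 / am)) * Real.sqrt (27 + 2025 / 8 * am))) (1 / 4) / 2) - min ((1 / (10 * Real.sqrt (max 2 (16 / am)) * Real.sqrt (27 + 2025 / 8 * am))) / 4) ((2 / ((1 + 25 / 8) * (600 * (27 / 4 : ℝ) ^ 6 + am))) / (3 * (Real.sqrt (max 2 (16 / am)) * (2 + Real.sqrt (max 2 (16 / am))) * (3 * Real.sqrt 3 + 27 + 9 * Real.sqrt am * Real.sqrt (25 / 8) + 81 * am * (25 / 8)) * (8 * Real.sqrt (max 2 (16 / am)) + 8 * Real.sqrt (max 2 (16 / am)) ^ 2) * (10 * Real.sqrt (25 / 8)) + 9 * (max 2 (16 / am)) * Real.sqrt (25 / 8))))))) ^ 3) ^ 2) * (2 * (1 + 1 / (min ((1 / (10 * Real.sqrt (max 2 (16 / am)) * Real.sqrt (27 + 2025 / 8 * am))) / 4) ((2 / ((1 + 25 / 8) * (600 * (27 / 4 : ℝ) ^ 6 + am))) / (3 * (Real.sqrt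 (max 2 (16 / am)) * (2 + Real.sqrt (max 2 (16 / am))) * (3 * Real.sqrt 3 + 27 + 9 * Real.sqrt am * Real.sqrt (25 / 8) + 81 * am * (25 / 8)) * (8 * Real.sqrt (max 2 (16 / am)) + 8 * Real.sqrt (max 2 (16 / am)) ^ 2) * (10 * Real.sqrt (25 / 8)) + 9 * (max 2 (16 / am)) * Real.sqrt (25 / 8)))) - (min ((1 / (10 * Real.sqrt (max 2 (16 / am)) * Real.sqrt (27 + 2025 / 8 * am))) / 4) ((2 / ((1 + 25 / 8) * (600 * (27 / 4 : ℝ) ^ 6 + am))) / (3 * (Real.sqrt (max 2 (16 / am)) * (2 + Real.sqrt (max 2 (16 / am))) * (3 * Real.sqrt 3 + 27 + 9 * Real.sqrt am * Real.sqrt (25 / 8) + 81 * am * (25 / 8)) * (8 * Real.sqrt (max 2 (16 / am)) + 8 * Real.sqrt (max 2 (16 / am)) ^ 2) * (10 * Real.sqrt (25 / 8)) + 9 * (max 2 (16 / am)) * Real.sqrt (25 / 8))))) / 2))) ^ 3)))) * Real.exp (-((min ((1 / (10 * Real.sqrt (max 2 (16 / am)) * Real.sqrt (27 + 2025 / 8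 * am))) / 4) ((2 / ((1 + 25 / 8) * (600 * (27 / 4 : ℝ) ^ 6 + am))) / (3 * (Real.sqrt (max 2 (16 / am)) * (2 + Real.sqrt (max 2 (16 / am))) * (3 * Real.sqrt 3 + 27 + 9 * Real.sqrt am * Real.sqrt (25 / 8) + 81 * am * (25 / 8)) * (8 * Real.sqrt (max 2 (16 / am)) + 8 * Real.sqrt (max 2 (16 / am)) ^ 2) * (10 * Real.sqrt (25 / 8)) + 9 * (max 2 (16 / am)) * Real.sqrt (25 / 8))))) / 2 * (Site.tdist (P := F.P K) (iterBlockOf (K - n) b.src) z : ℝ))) := by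
  have hc₀ : 0 < c₀ := Fact.out
  have hL : (0 : ℝ) < F.L := by have := F.hL.2; exact_mod_cast (by omega : 0 < F.L)
  have hε7 : 10 ^ 7 * (F.L : ℝ) ^ 3 * ε₀ ≤ 1 := by
    have h1 : (10 : ℝ) ^ 7 * (F.L : ℝ) ^ 3 * ε₀ ≤ 10 ^ 12 * (F.L : ℝ) ^ 3 * ε₀ := by
      have : 0 ≤ (F.L : ℝ) ^ 3 * ε₀ := by positivity
      nlinarith only [this]
    exact h1.trans hε12
  -- the `Q″` of record, its ∃-form top-mean clause and `ker Q″ ≤ N_S`; the Lift identity `R_S = projR Δ Q″`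
  obtain ⟨Q'', D', -, -, htop, hseq, hker⟩ := exists_intertwiner_of_regPr F h (c₀ := c₀) cB hε₀ hε12 U₀ hreg
  have hRS := RS_eq_projR_of_lift F h cB hε₀ hε12 U₀ hreg hLift Q'' htop hker
  -- the LOD data at the pinned weight: `ι` by `rfl`, `T := (ι∘Q″)†`, `G ← exists_massive_inverse`
  haveI : Fact (0 < (c₀ * ((F.L : ℝ) ^ 3) ^ (K - n))) := ⟨by positivity⟩
  obtain ⟨ι', hι'⟩ : ∃ ι' : (Site (F.P K) (K - n) → Matrix (Fin 2) (Fin 2) ℂ) →ₗ[ℂ] SiteL2K ℂ 3 (periodsT3 F n) (c₀ * ((F.L : ℝ) ^ 3) ^ (K - n)) W₂,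
      ∀ c, ι' c = toL2S F n (c₀ * ((F.L : ℝ) ^ 3) ^ (K - n)) (fun z => c (siteShift (sites_eq F n K h) z)) :=
    ⟨(toL2S F n (c₀ * ((F.L : ℝ) ^ 3) ^ (K - n))).toLinearMap ∘ₗ LinearMap.funLeft ℂ (Matrix (Fin 2) (Fin 2) ℂ) (siteShift (sites_eq F n K h)), fun c => rfl⟩
  obtain ⟨T', hT'⟩ : ∃ T' : SiteL2K ℂ 3 (periodsT3 F n) (c₀ * ((F.L : ℝ) ^ 3) ^ (K - n)) W₂ →ₗ[ℂ] SiteL2K ℂ 3 (periodsT3 F K) c₀ W₂,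
      ∀ (l : SiteL2K ℂ 3 (periodsT3 F K) c₀ W₂) (f : SiteL2K ℂ 3 (periodsT3 F n) (c₀ * ((F.L : ℝ) ^ 3) ^ (K - n)) W₂), ⟪ι' (Q'' l), f⟫_ℂ = ⟪l, T' f⟫_ℂ :=
    ⟨LinearMap.adjoint (ι' ∘ₗ Q''), fun l f => by rw [LinearMap.adjoint_inner_right, LinearMap.comp_apply]⟩
  obtain ⟨G', hAG', hGA', -⟩ := exists_massive_inverse F h hε₀ hε7 U₀ hreg Q'' hseq ι' hι' T' hT' ham
  exact hc2b_pin F h hε₀ hε7 U₀ hreg Q'' hseq hRS hker hnK ham ι' hι' T' hT' G' hAG' hGA' ha' hroom hsmall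

end Summit.QuantumFields.YangMills.Theorems.Prop7GaugeProjectorBlockPackageMemberOfLift

end
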